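import Mathlib
import HarnessLib
import Summits.HubbardSuperconductivity.HubbardSuperconductivity.Theorems.KLProgrammeKLRegimeEnginePairTransferMemberDefectRowsFactor

/-!
# Route `KLProgramme` — ENGINE child gen 8 (stmt-HubbardSuperconductivity-20437 `KLRegimeEngineV17F2`), skeleton v2 class #5 rev 3: the LOCALISATION class of the ξ doors SPLIT
# into frequency-pinning differences + the off-ball part — `klmd_locKernel_split`, **`klmd_loc_eq_split`**, **`klmd_loc_le_rows`**
# (cell gate-hubbard-kl, seat hubbard-kl-k3c1-p1 g13, technique «composed-map remainder propagation»; model-free, instantiates on the pins `V := V j t`, `Br := Br j Qm t`)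

WHY.  In `klmd_pinnedDefect_eq_resolved` / the ξ doors (rows 31–41b of KLTC-INDEX v10) the localisation class is `LOC = Σ_z Br(z)·(𝟙[z₁ ∈ ball]·V(x̂,ẑ₀)V(ẑ₀,ŷ) − V(x̂,z)V(z,ŷ))`,
`ẑ₀ = (z₁, ω₀)`: the rung rate against the difference between the kernels with the loop frequency PINNED to `ω₀` and RESOLVED at `ν = z₂`.  Its gain is a frequency-pinning
REMAINDER; this file propagates it exactly (`a₀b₀ − ab = (a₀ − a)b₀ + a(b₀ − b)`):
* `klmd_locKernel_split` — per `z`: `LK(z) = 𝟙[z₁ ∈ ball]·((V(x̂,ẑ₀) − V(x̂,z))·V(ẑ₀,ŷ) + V(x̂,z)·(V(ẑ₀,ŷ) − V(z,ŷ))) − 𝟙[z₁ ∉ ball]·V(x̂,z)V(z,ŷ)`;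
* **`klmd_loc_eq_split`** — the class: `LOC = Σ_z Br(z)·𝟙[z₁ ∈ ball]·(…two pinning differences…) − Σ_z Br(z)·𝟙[z₁ ∉ ball]·V(x̂,z)V(z,ŷ)` (the second sum is the OFF-BALL
  rate mass — zero by support once the slice line lives inside the ball);
* **`klmd_loc_le_rows`** — `‖LOC‖ ≤ Σ_z ‖Br z‖·(𝟙[z₁ ∈ ball]·(δ₁(z)·M + M·δ₂(z)) + 𝟙[z₁ ∉ ball]·M²)` from a kernel sup `M` and the two frequency-pinning rows
  `‖V(x̂,ẑ₀) − V(x̂,z)‖ ≤ δ₁ z`, `‖V(ẑ₀,ŷ) − V(z,ŷ)‖ ≤ δ₂ z` (the rows where the localisation gain `|ν − ω₀|·‖∂_ν V‖` lives) — the RL rows of rows 40/41 in the currency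
  «rate mass weighted by frequency-pinning moduli».
Pure finite-sum algebra on abstract `V`, `Br`; nothing about the model is asserted; nothing asserts (X).3, (c), K3 or superconductivity.  0 kit · 0 lit.
-/

noncomputable section

namespace Summit.HubbardSuperconductivity.HubbardSuperconductivity.Theorems.KLRegimeSplit

set_option linter.dupNamespace false -- summit = problem name (single-conjunct summit), D-0017

open Finset Matrix Set Literature.MathematicalPhysics.QuantumLattice Literature.Probability.LatticeModels GrassmannAlgebra
open Summit.HubbardSuperconductivity.HubbardSuperconductivity.Theorems.KLProgrammeLegKernels
open Summit.HubbardSuperconductivity.HubbardSuperconductivity.Theorems.TwoPointAssembly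
open Summit.HubbardSuperconductivity.HubbardSuperconductivity.Theorems.KLRegimeWick

variable (L M : ℕ) [NeZero L] [NeZero M]

/-- **Per-`z` split of the localisation kernel**: `𝟙·a₀b₀ − ab = 𝟙·((a₀ − a)b₀ + a(b₀ − b)) − 𝟙ᶜ·ab`. -/
theorem klmd_locKernel_split (μ : ℝ) (Qm x y : TorusSite 2 L) (V : (Fin 4 → HubbardFieldIdx L M) → ℂ) (z : TorusSite 2 L × MatsubaraIdx M) :
    ((if z.1 ∈ klBall L μ 0 then
              V ![(((omega0 M, z.1), 0), 0), ((((omega0 M).rev, Qm - z.1), 1), 0), ((((omega0 M).rev, Qm - x), 1), 1), (((omega0 M, x), 0), 1)] *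
                V ![(((omega0 M, y), 0), 0), ((((omega0 M).rev, Qm - y), 1), 0), ((((omega0 M).rev, Qm - z.1), 1), 1), (((omega0 M, z.1), 0), 1)]
            else 0) -
            V ![(((z.2, z.1), 0), 0), (((z.2.rev, Qm - z.1), 1), 0), ((((omega0 M).rev, Qm - x), 1), 1), (((omega0 M, x), 0), 1)] *
              V ![(((omega0 M, y), 0), 0), ((((omega0 M).rev, Qm - y), 1), 0), (((z.2.rev, Qm - z.1), 1), 1), (((z.2, z.1), 0), 1)]) =
      (if z.1 ∈ klBall L μ 0 then
          (V ![(((omega0 M, z.1), 0), 0), ((((omega0 M).rev, Qm - z.1), 1), 0), ((((omega0 M).rev, Qm - x), 1), 1), (((omega0 M, x), 0), 1)] - V ![(((z.2, z.1), 0), 0), (((z.2.rev, Qm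
                  - z.1), 1), 0), ((((omega0 M).rev, Qm - x), 1), 1), (((omega0 M, x), 0), 1)]) *
              V ![(((omega0 M, y), 0), 0), ((((omega0 M).rev, Qm - y), 1), 0), ((((omega0 M).rev, Qm - z.1), 1), 1), (((omega0 M, z.1), 0), 1)] +
            V ![(((z.2, z.1), 0), 0), (((z.2.rev, Qm - z.1), 1), 0), ((((omega0 M).rev, Qm - x), 1), 1), (((omega0 M, x), 0), 1)] *
              (V ![(((omega0 M, y), 0), 0), ((((omega0 M).rev, Qm - y), 1), 0), ((((omega0 M).rev, Qm - z.1), 1), 1), (((omega0 M, z.1), 0), 1)] - V ![(((omega0 M, y), 0), 0),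
                      ((((omega0 M).rev, Qm - y), 1), 0), (((z.2.rev, Qm - z.1), 1), 1), (((z.2, z.1), 0), 1)])
        else 0) -
        (if z.1 ∈ klBall L μ 0 then 0 else
          V ![(((z.2, z.1), 0), 0), (((z.2.rev, Qm - z.1), 1), 0), ((((omega0 M).rev, Qm - x), 1), 1), (((omega0 M, x), 0), 1)] *
            V ![(((omega0 M, y), 0), 0), ((((omega0 M).rev, Qm - y), 1), 0), (((z.2.rev, Qm - z.1), 1), 1), (((z.2, z.1), 0), 1)]) := by
  split_ifs <;> ring

/-- **The localisation class split**: pinning differences on the ball + the off-ball rate mass. -/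
theorem klmd_loc_eq_split (μ : ℝ) (Qm x y : TorusSite 2 L) (V : (Fin 4 → HubbardFieldIdx L M) → ℂ) (Br : TorusSite 2 L × MatsubaraIdx M → ℂ) :
    ∑ z : TorusSite 2 L × MatsubaraIdx M, Br z *
          ((if z.1 ∈ klBall L μ 0 then
              V ![(((omega0 M, z.1), 0), 0), ((((omega0 M).rev, Qm - z.1), 1), 0), ((((omega0 M).rev, Qm - x), 1), 1), (((omega0 M, x), 0), 1)] *
                V ![(((omega0 M, y), 0), 0), ((((omega0 M).rev, Qm - y), 1), 0), ((((omega0 M).rev, Qm - z.1), 1), 1), (((omega0 M, z.1), 0), 1)]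
            else 0) -
            V ![(((z.2, z.1), 0), 0), (((z.2.rev, Qm - z.1), 1), 0), ((((omega0 M).rev, Qm - x), 1), 1), (((omega0 M, x), 0), 1)] *
              V ![(((omega0 M, y), 0), 0), ((((omega0 M).rev, Qm - y), 1), 0), (((z.2.rev, Qm - z.1), 1), 1), (((z.2, z.1), 0), 1)]) =
      ∑ z : TorusSite 2 L × MatsubaraIdx M, Br z *
          (if z.1 ∈ klBall L μ 0 then
            (V ![(((omega0 M, z.1), 0), 0), ((((omega0 M).rev, Qm - z.1), 1), 0), ((((omega0 M).rev, Qm - x), 1), 1), (((omega0 M, x), 0), 1)] - V ![(((z.2, z.1), 0), 0), (((z.2.rev,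
                    Qm - z.1), 1), 0), ((((omega0 M).rev, Qm - x), 1), 1), (((omega0 M, x), 0), 1)]) *
                V ![(((omega0 M, y), 0), 0), ((((omega0 M).rev, Qm - y), 1), 0), ((((omega0 M).rev, Qm - z.1), 1), 1), (((omega0 M, z.1), 0), 1)] +
              V ![(((z.2, z.1), 0), 0), (((z.2.rev, Qm - z.1), 1), 0), ((((omega0 M).rev, Qm - x), 1), 1), (((omega0 M, x), 0), 1)] *
                (V ![(((omega0 M, y), 0), 0), ((((omega0 M).rev, Qm - y), 1), 0), ((((omega0 M).rev, Qm - z.1), 1), 1), (((omega0 M, z.1), 0), 1)] - V ![(((omega0 M, y), 0), 0),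
                        ((((omega0 M).rev, Qm - y), 1), 0), (((z.2.rev, Qm - z.1), 1), 1), (((z.2, z.1), 0), 1)])
          else 0) -
        ∑ z : TorusSite 2 L × MatsubaraIdx M, Br z *
          (if z.1 ∈ klBall L μ 0 then 0 else
            V ![(((z.2, z.1), 0), 0), (((z.2.rev, Qm - z.1), 1), 0), ((((omega0 M).rev, Qm - x), 1), 1), (((omega0 M, x), 0), 1)] *
              V ![(((omega0 M, y), 0), 0), ((((omega0 M).rev, Qm - y), 1), 0), (((z.2.rev, Qm - z.1), 1), 1), (((z.2, z.1), 0), 1)]) := by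
  rw [← Finset.sum_sub_distrib]
  refine Finset.sum_congr rfl fun z _ => ?_
  rw [klmd_locKernel_split L M μ Qm x y V z]
  ring

/-- **The localisation row from frequency-pinning moduli**: with `‖V X‖ ≤ M` for all labels and, for every `z`, `‖V(x̂,ẑ₀) − V(x̂,z)‖ ≤ δ₁ z`, `‖V(ẑ₀,ŷ) − V(z,ŷ)‖ ≤ δ₂ z`:
`‖LOC‖ ≤ Σ_z ‖Br z‖·(𝟙[z₁ ∈ ball](δ₁ z·Mv + Mv·δ₂ z) + 𝟙[z₁ ∉ ball]·Mv²)` (`‖V X‖ ≤ Mv`). -/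
theorem klmd_loc_le_rows (μ : ℝ) (Qm x y : TorusSite 2 L) (V : (Fin 4 → HubbardFieldIdx L M) → ℂ) (Br : TorusSite 2 L × MatsubaraIdx M → ℂ) {Mv : ℝ}
    (δ₁ δ₂ : TorusSite 2 L × MatsubaraIdx M → ℝ) (hM : ∀ X, ‖V X‖ ≤ Mv)
    (hδ₁ : ∀ z : TorusSite 2 L × MatsubaraIdx M, ‖V ![(((omega0 M, z.1), 0), 0), ((((omega0 M).rev, Qm - z.1), 1), 0), ((((omega0 M).rev, Qm - x), 1), 1), (((omega0 M, x), 0), 1)] - V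
            ![(((z.2, z.1), 0), 0), (((z.2.rev, Qm - z.1), 1), 0), ((((omega0 M).rev, Qm - x), 1), 1), (((omega0 M, x), 0), 1)]‖ ≤ δ₁ z)
    (hδ₂ : ∀ z : TorusSite 2 L × MatsubaraIdx M, ‖V ![(((omega0 M, y), 0), 0), ((((omega0 M).rev, Qm - y), 1), 0), ((((omega0 M).rev, Qm - z.1), 1), 1), (((omega0 M, z.1), 0), 1)] - V
            ![(((omega0 M, y), 0), 0), ((((omega0 M).rev, Qm - y), 1), 0), (((z.2.rev, Qm - z.1), 1), 1), (((z.2, z.1), 0), 1)]‖ ≤ δ₂ z) :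
    ‖∑ z : TorusSite 2 L × MatsubaraIdx M, Br z *
          ((if z.1 ∈ klBall L μ 0 then
              V ![(((omega0 M, z.1), 0), 0), ((((omega0 M).rev, Qm - z.1), 1), 0), ((((omega0 M).rev, Qm - x), 1), 1), (((omega0 M, x), 0), 1)] *
                V ![(((omega0 M, y), 0), 0), ((((omega0 M).rev, Qm - y), 1), 0), ((((omega0 M).rev, Qm - z.1), 1), 1), (((omega0 M, z.1), 0), 1)]
            else 0) -
            V ![(((z.2, z.1), 0), 0), (((z.2.rev, Qm - z.1), 1), 0), ((((omega0 M).rev, Qm - x), 1), 1), (((omega0 M, x), 0), 1)] *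
              V ![(((omega0 M, y), 0), 0), ((((omega0 M).rev, Qm - y), 1), 0), (((z.2.rev, Qm - z.1), 1), 1), (((z.2, z.1), 0), 1)])‖ ≤
      ∑ z : TorusSite 2 L × MatsubaraIdx M, ‖Br z‖ * ((if z.1 ∈ klBall L μ 0 then δ₁ z * Mv + Mv * δ₂ z else 0) + (if z.1 ∈ klBall L μ 0 then 0 else Mv * Mv)) := by
  have hM0 : 0 ≤ Mv := (norm_nonneg _).trans (hM fun _ => (((omega0 M, x), 0), 0))
  refine klmd_sum1_mul_le _ _ _ fun z => ?_
  rw [klmd_locKernel_split L M μ Qm x y V z]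
  refine (norm_sub_le _ _).trans (add_le_add ?_ ?_)
  · split_ifs with h
    · refine (norm_add_le _ _).trans (add_le_add ?_ ?_)
      · rw [norm_mul]; exact mul_le_mul (hδ₁ z) (hM _) (norm_nonneg _) ((norm_nonneg _).trans (hδ₁ z))
      · rw [norm_mul]; exact mul_le_mul (hM _) (hδ₂ z) (norm_nonneg _) hM0
    · simp
  · split_ifs with h
    · simp
    · rw [norm_mul]; exact mul_le_mul (hM _) (hM _) (norm_nonneg _) hM0

end Summit.HubbardSuperconductivity.HubbardSuperconductivity.Theorems.KLRegimeSplit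

end
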